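import Summits.CriticalPhenomena.PercolationContinuityZ3.Theses.PercNearOneGluing
import Literature.Probability.Percolation.PercolationProofs
import Literature.Probability.Percolation.ConditionalPositiveAssociationProofs
import Literature.Probability.Percolation.TwoClusterConditionalAssociationProofs
import Summits.CriticalPhenomena.PercolationContinuityZ3.Theorems.PercNearOneGluingAdditiveGluingGoodStep

/-! TTRL-lite variant V3342 of stmt-CriticalPhenomena-4576

(`stub_goodStep`, move `lemma_proposal`): the induction-hypothesis instance actually used in the
`{y}`-branch of every Theorem-5-style proof — goodness of `(w°, A, y, b)` for the star-deleted
weighting `w° = w[o-pairs := 0]` with a neighbour `y ∉ A` of `o` (`w(o–y) ≠ 0`) as the new observer.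
It is the displayed induction hypothesis applied to `w°`, whose set of positive-degree vertices is
strictly smaller (`goodStep_card_lt`: `o` loses its positive degree).
-/

namespace Summit.CriticalPhenomena.PercolationContinuityZ3.Theorems

open MeasureTheory Literature.Probability.LatticeModels Literature.Probability.Percolation
open scoped Classical BigOperators

/-- TTRL-lite variant V3342 of `stub_goodStep` (stmt-CriticalPhenomena-4576): the induction
hypothesis of the good-quadruple induction, instantiated at the star-deleted weighting
`fun e => if o ∈ e then 0 else w e`, the same relay set `A ∋ b`, and a new observer `y ∉ A` with
`w(o–y) ≠ 0`; the measure decrease is `goodStep_card_lt`. -/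
theorem stub_goodStep_var3342 :
    ∀ (n : ℕ) (w : Sym2 (Fin n) → unitInterval) (A : Finset (Fin n)) (o b : Fin n) (y : Fin n), b ∈ A → y ∉ A → (w s(o, y) : ℝ) ≠ 0 → (∀ w' : Sym2 (Fin n) → unitInterval, (Finset.univ.filter (fun v : Fin n => ∃ u : Fin n, 0 < (w' s(u, v) : ℝ))).card < (Finset.univ.filter (fun v : Fin n => ∃ u : Fin n, 0 < (w s(u, v) : ℝ))).card → ∀ (A' : Finset (Fin n)) (o' b' : Fin n), b' ∈ A' → o' ∉ A' → ∀ (t : ℝ) (sel : Finset (Fin n) → Fin n), (∀ W, sel W ∈ A') → (∀ a ∈ A', 1 - t ≤ (prodBernoulli w').real (openConn a b')) → (prodBernoulli w').real ((⋃ a ∈ A', openConn o' a) ∩ (openConn o' b')ᶜ) + ∑ W ∈ (Finset.univ : Finset (Finset (Fin n))).filter (fun W => o' ∈ W ∧ Disjoint W A'), (prodBernoulli w').real {ω : BondConfig (Fin n) | openCluster ω o' = (W : Set (Fin n))} * (prodBernoulli w').real (openConnIn ((W : Set (Fin n))ᶜ) (sel W) b')ᶜ ≤ t) → ∀ (t :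 ℝ) (sel : Finset (Fin n) → Fin n), (∀ W, sel W ∈ A) → (∀ a ∈ A, 1 - t ≤ (prodBernoulli (fun e : Sym2 (Fin n) => if o ∈ e then (0 : unitInterval) else w e)).real (openConn a b)) → (prodBernoulli (fun e : Sym2 (Fin n) => if o ∈ e then (0 : unitInterval) else w e)).real ((⋃ a ∈ A, openConn y a) ∩ (openConn y b)ᶜ) + ∑ W ∈ (Finset.univ : Finset (Finset (Fin n))).filter (fun W => y ∈ W ∧ Disjoint W A), (prodBernoulli (fun e : Sym2 (Fin n) => if o ∈ e then (0 : unitInterval) else w e)).real {ω : BondConfig (Fin n) | openCluster ω y = (W : Set (Fin n))} * (prodBernoulli (fun e : Sym2 (Fin n) => if o ∈ e then (0 : unitInterval) else w e)).real (openConnIn ((W : Set (Fin n))ᶜ) (sel W) b)ᶜ ≤ t := by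
  intro n w A o b y hb hy hw ih
  exact ih _ (goodStep_card_lt w hw) A y b hb hy

end Summit.CriticalPhenomena.PercolationContinuityZ3.Theorems
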